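import Literature.Claims.NS.Kampen2014
import HarnessLib

/-!
# Claim skeleton (D-0090 NS-CLAIMS, C41): Maoting Tong & Daorong Ton, «Smooth Global Solution of the
# Navier-Stokes Equation», arXiv:2001.11699 v10 (2 Aug 2026) — semigroup / `L_p(ℝ³)` framework

Cell `ns-claims`, row C41 (census slug `TongTon2020`; §0.2 queue v1.16), typist `ns-claims-typist-12` (lanes:
refuter first idle (PREDICTED-R), ref-1 g2, salvage by family, writer-1, lit-3). Text of record (PINNED by
ns-claims-lit-3, `pub/ns-claims/sources/TongTon2026/LOCATORS.md`): arXiv 2001.11699 **v10** (2026-08-02, 26 pp.,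
PDF-only; page = PDF page of `arXiv-2001.11699v10-PDF+text_PINNED/`), bib `TongTon2026`; versions: v1 (2020)
carried the Schwartz decay hypothesis of Clay (A), v6 (2023) withdrawn, arXiv comment since then «need
rewrite», v9/v10 (2026). UNREFEREED CLAIM under adjudication — NOTHING in this file asserts a step: every
`Step_k`/`Lemma4*`/`ClaimedTheorem` is a `Prop`; the `theorem`s are kernel compositions of the paper's own
implications, the Clay link, and the (true) energy bound of Step 4. Card `pub/ns-claims/claims/TongTon2020/
CARD.md` (PREDICTION §4 frozen 2026-08-27T00:16:14Z, sha16 c3327ce75864c992).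

## Claimed statement (as printed)

**Theorem 1 p. 17** (= abstract p. 1): «Suppose that the given externally applied force f(t,x) = 0. In the
framework function space L_p(R³), the Navier-Stokes equation (1) has a unique smooth global solution p(t,x),
u(t,x) on [t₀,∞) × R³ with bounded energy if and only if the initial value u₀ is smooth and divergence free
vector field.» Setting (1) p. 1: `ℝ³`, `ν = 1`, `f ≡ 0`; `X = D_{L_p}(ℝ³)` = closure of `C^∞_{0,σ}` in `L_p`
(pp. 3–4), data in `D((−Δ)^{1/2})`; p. 21: «Let p = 2 … Therefore, we have bounded energy». RENDERING: the
sufficiency half at `N = 3` over the tree's BKM vocabulary (reused from the C13 skeleton: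
`Kampen2014.IsDatum` — smooth, divergence free, every derivative in `L²` (the `p = 2` reading of the data
class, which is where the print lands for the energy); `Kampen2014.IsGlobalSolution` — classical on
`ℝ³ × [0,∞)` with Sobolev bounds on compacts) plus `HasBoundedEnergy`; every `ν > 0` (the print fixes `ν = 1`;
the class is invariant under the NS scaling `u(x,t) ↦ νu(x,νt)`, `p ↦ ν²p(x,νt)`, so the `ν = 1` statement for
all data is the statement for all `ν > 0`). The necessity half («only if») and uniqueness are not composed
(`ClaimedNecessity` records the former). TODO(general form): `p ≠ 2` data without decay, `t₀ ≠ 0`.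

## Clay delta (reference `Literature.Claims.NS.ClayVariants`, axes Δ1–Δ8)

Nearest (A). Δ1 `ℝ³` = · Δ2 = · Δ3 `f ≡ 0` = · Δ4 data «smooth and divergence free» in `D_{L_p}` with NO decay
hypothesis (v1 had (4); v10 dropped it): BROADER than (A) — rendered on `H^∞` (⊇ Schwartz) · Δ5/Δ6 smooth
global + bounded energy = (6)(7) (+ uniqueness, + «only if») · Δ7 `ν = 1` (= every `ν` by scaling).
`clay_of_claimed : ClaimedTheorem → ClayVariants.clayR3.Regularity` PROVED — no wrong-problem axis.

## Steps — ORDERED INDEX (TYPING-HYGIENE 11; print order)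

Step 1 = Lemma 2 p. 5 (Δ|_X generates an analytic contraction semigroup — Pazy Thm 2.5.2(c); classical,
quoted) · **Step 2 = Lemma 4 p. 9** [proof pp. 9–15]: «Let −A be the infinitesimal generator of an analytic
semigroup T(t) on the Banach space X = D_{L_p}(R³) satisfying ‖T(t)‖ ≤ 1. If α = 1/2 and f satisfies the
assumption (F) [(12) p. 9: local Hölder–Lipschitz on V = {(t,u) : t₀ ≤ t, ‖u − u₀‖ ≤ δ}], then for any initial
data (t₀,u₀) ∈ U, the equation du/dt + Au = f(t,u(t)), t ∈ (t₀,∞), u(t₀) = u₀ (13) with f(t,u(t)) = −(u·∇)u has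
a global solution u ∈ C([t₀,∞): D_{L_p}) ∩ C¹((t₀,∞): D_{L_p})» — GLOBAL existence from the hypotheses of the
LOCAL semilinear theorem (Pazy §6.3); typed twice: `Lemma4` (the NS-level statement, rendered: every datum
launches a global classical solution) and `Lemma4Abs` (the lemma at the grain of its own proof — abstract
generator, any f with (F) — in the scalar instance family `X = ℝ`, `A = a ≥ 0`, `T(t) = e^{−at}`; HYGIENE 13);
typist's flag: suspicious (load-bearing; `u′ + u = u + u²` blows up) · **Step 3 = `Step_31Abs`** (p. 14,
(30)–(31), inside the proof of Lemma 4: the fixed point `y₀` of the map (21) — whose Duhamel integral runs over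
`[t₀, t₁]` ONLY — is turned into «a global solution of (13)» by «A^α u(t) = T(t−t₀)A^αu₀ + ∫_{t₀}^{t₁} A^αT(t−s)
f(s, A^{−α}y₀(s)) ds = (t+1)y₂(t), t ∈ [t₁,∞)» set equal to the full Duhamel formula (30) with `∫_{t₀}^{t}`; typed
at the scalar grain as the displayed identity of the two integrals for `t ≥ t₁`; typist's flag: suspicious —
the located computation) · **Step 4 = `Step_S4`** (p. 21 Step 4: «‖y₀(t)‖ ≤ M … Since (−Δ)^{−1/2} is bounded,
‖u(t,x)‖_{D_{L_p}} ≤ ‖(−Δ)^{−1/2}‖ M … Let p = 2 … Therefore, we have bounded energy» — the printed reason is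
unsound (`(−Δ)^{−1/2}` is unbounded on `L_p(ℝ³)`), but the typed STATEMENT — a global classical solution of the
class from an `H^∞` datum has bounded energy — is TRUE for `ν > 0` and PROVED here (`step_S4_holds`, energy
inequality `IsClassicalNSSolutionOn.bkm_energy_le`)) · Step 5 = smoothness (pp. 20–21 via Giga–Miyakawa /
Miyakawa; Appendix pp. 23–24) — folded into the rendering (classical solutions).

## COMPOSITION — proved as `claim_of_steps`

`claim_of_steps : Lemma4 → Step_S4 → ClaimedTheorem` — PROVED (global solution from Lemma 4 as rendered, energy
from Step 4); with `step_S4_holds` the claim reduces to `Lemma4` alone (`claim_of_lemma4`). `Lemma4Abs` and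
`Step_31Abs` are the abstract-grain companions of Lemma 4's statement and of its proof's decisive line.

Design notes. Vocabulary imported from `Literature.Claims.NS.Kampen2014` (`IsDatum`, `IsGlobalSolution`);
no notation, no instance. Scalar companions use `Real.exp`, `HasDerivAt`, `intervalIntegral`.

WHAT THIS IS NOT: not a claim about NS regularity or blow-up; not a claim about any author beyond the
typed locator.
-/

noncomputable section

open Set Function Filter MeasureTheory intervalIntegral
open scoped Topology ENNReal NNReal ContDiff
open Literature.Analysis.FluidPDE
open Literature.Claims.NS.Kampen2014 (IsDatum IsGlobalSolution)

namespace Literature.Claims.NS.TongTon2020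

/-- `ℝ³`. [cite: TongTon2026, (1) p. 1] -/
abbrev E3 := EuclideanSpace ℝ (Fin 3)

/-! ### The claimed statement -/

/-- **Theorem 1 p. 17, sufficiency half (rendered; see module docstring)**: for every `ν > 0` and every datum
of the class there is a global classical solution on `ℝ³ × [0,∞)` with bounded energy («the Navier-Stokes
equation (1) has a unique smooth global solution p(t,x), u(t,x) on [t₀,∞) × R³ with bounded energy if … the
initial value u₀ is smooth and divergence free»). [cite: TongTon2026, Theorem 1 p. 17; abstract p. 1; p. 21] -/
def ClaimedTheorem : Prop :=
  ∀ ν : ℝ, 0 < ν → ∀ u₀ : E3 → E3, IsDatum u₀ →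
    ∃ (u : ℝ → E3 → E3) (p : ℝ → E3 → ℝ), IsGlobalSolution ν u₀ u p ∧ HasBoundedEnergy u

/-- **Theorem 1, necessity half («only if»), p. 21–22**: «Suppose that the Navier-Stokes equation (1) has a
unique smooth global solution u. Then u satisfies (1), and so u₀ ∈ C^∞_{0,σ}(R³)» — if a global classical
solution with datum `u₀` exists then `u₀` is smooth and divergence free. Not composed. Typist's flag: true
(definitional in the rendered class). [cite: TongTon2026, Theorem 1 p. 17; Necessity pp. 21–22] -/
def ClaimedNecessity : Prop :=
  ∀ ν : ℝ, 0 < ν → ∀ (u₀ : E3 → E3) (u : ℝ → E3 → E3) (p : ℝ → E3 → ℝ),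
    IsGlobalSolution ν u₀ u p → ContDiff ℝ ∞ u₀ ∧ VectorCalculus.IsDivFree u₀

/-! ### The steps -/

/-- **Step 2 — Lemma 4 p. 9, at the Navier–Stokes level (rendered)**: for every datum of the class the
projected equation (32) `du/dt = Δu + F(t,u)`, `F = −(u·∇)u` (p. 17, Step 1) has a GLOBAL solution on
`[t₀,∞)` (Lemma 4's conclusion «has a global solution u ∈ C([t₀,∞): D_{L_p}) ∩ C¹((t₀,∞): D_{L_p})», made
classical by pp. 20–21). RENDERED: a global classical solution in the BKM class, every `ν > 0`. Typist's flag: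
suspicious — this is (A)-strength; its printed proof is `Lemma4Abs`/`Step_31Abs`.
[cite: TongTon2026, Lemma 4 p. 9; Step 3 pp. 19–20] -/
def Lemma4 : Prop :=
  ∀ ν : ℝ, 0 < ν → ∀ u₀ : E3 → E3, IsDatum u₀ →
    ∃ (u : ℝ → E3 → E3) (p : ℝ → E3 → ℝ), IsGlobalSolution ν u₀ u p

/-- Assumption (F), (12) p. 9, in the scalar instance: «for every (t,u) ∈ U there is a neighborhood V ⊂ U
and constants L ≥ 0, 0 < ϑ ≤ 1 such that for all (t_i,u_i) ∈ V: ‖f(t₁,u₁) − f(t₂,u₂)‖ ≤ L(|t₁ − t₂|^ϑ +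
‖u₁ − u₂‖^α)» with `α = 1/2`-graph norm = the norm here (`A = a·Id`) — on the set `V = {(t,u) : t₀ ≤ t,
‖u − u₀‖ ≤ δ}` used in the proof (p. 9, Step 1). [cite: TongTon2026, (12) p. 9; proof of Lemma 4, Step 1 p. 9] -/
def AssumptionF (g : ℝ → ℝ → ℝ) (t₀ x₀ : ℝ) : Prop :=
  ∃ δ L θ : ℝ, 0 < δ ∧ 0 ≤ L ∧ 0 < θ ∧ θ ≤ 1 ∧
    ∀ t₁ t₂ x₁ x₂ : ℝ, t₀ ≤ t₁ → t₀ ≤ t₂ → |x₁ - x₀| ≤ δ → |x₂ - x₀| ≤ δ →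
      |g t₁ x₁ - g t₂ x₂| ≤ L * (|t₁ - t₂| ^ θ + |x₁ - x₂|)

/-- **Step 2, abstract companion — Lemma 4 at the grain of its own proof (TYPING-HYGIENE 13)**, in the scalar
instance family `X = ℝ`, `A = a ≥ 0` (so `−A` generates the analytic contraction semigroup `T(t) = e^{−at}`,
`‖T(t)‖ ≤ 1`, and the proof's ingredients (14)–(21) apply verbatim): if `g` satisfies (F) near `(t₀,x₀)` then
`u′ + a u = g(t,u)`, `u(t₀) = x₀` has a GLOBAL solution, continuous on `[t₀,∞)` and differentiable on
`(t₀,∞)`. (The printed lemma names `X = D_{L_p}(R³)` and `f = −(u·∇)u`; its proof uses only the abstract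
hypotheses.) Typist's flag: suspicious (`a = 1`, `g(t,u) = u + u²`, `x₀ = 1`: `u′ = u²`).
[cite: TongTon2026, Lemma 4 p. 9; proof pp. 9–15] -/
def Lemma4Abs : Prop :=
  ∀ (a : ℝ), 0 ≤ a → ∀ (g : ℝ → ℝ → ℝ) (t₀ x₀ : ℝ), AssumptionF g t₀ x₀ →
    ∃ u : ℝ → ℝ, ContinuousOn u (Ici t₀) ∧ u t₀ = x₀ ∧
      ∀ t : ℝ, t₀ < t → HasDerivAt u (g t (u t) - a * u t) t

/-- **Step 3 — (30)–(31) p. 14, the decisive line of the proof of Lemma 4, scalar grain**: the full Duhamel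
formula (30) `u(t) = T(t−t₀)u₀ + ∫_{t₀}^{t} T(t−s) f(s,·) ds` is set equal, for `t ∈ [t₁,∞)`, to the fixed
point's formula (21)/(31) whose integral runs over `[t₀,t₁]` only: «A^α u(t) = T(t−t₀)A^αu₀ + ∫_{t₀}^{t₁}
A^αT(t−s) f(s, A^{−α}y₀(s)) ds = (t+1)y₂(t), t ∈ [t₁,∞) … is a global solution of (13)». TYPED as that identity
of integrals with `T(t) = e^{−at}` and a continuous inhomogeneity `h`. Typist's flag: suspicious (`a = 0`,
`h ≡ 1`: `t − t₀ ≠ t₁ − t₀` for `t > t₁`). [cite: TongTon2026, (30)–(31) p. 14; (21) p. 13] -/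
def Step_31Abs : Prop :=
  ∀ (a t₀ t₁ : ℝ) (h : ℝ → ℝ), 0 ≤ a → t₀ < t₁ → Continuous h →
    ∀ t : ℝ, t₁ ≤ t →
      ∫ s in t₀..t, Real.exp (-(a * (t - s))) * h s = ∫ s in t₀..t₁, Real.exp (-(a * (t - s))) * h s

/-- **Step 4 — p. 21, Step 4 (bounded energy)**: «From the proof of Lemma 4 … the fixed point y₀(t) in formula
(21) belongs to Y … ‖y₀(t)‖ ≤ M is bounded for t ∈ [t₀,∞) … Since (−Δ)^{−1/2} is bounded, ‖u(t,x)‖_{D_{L_p}} ≤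
‖(−Δ)^{−1/2}‖ M … Let p = 2 … Therefore, we have bounded energy.» TYPED as the statement reached: every global
classical solution of the class from a datum of the class has bounded energy (`ν > 0`). The printed REASON
(boundedness of `(−Δ)^{−1/2}` on `L_p(ℝ³)`) is not typed; the statement is TRUE by the energy inequality and
PROVED below (`step_S4_holds`). [cite: TongTon2026, Step 4 p. 21] -/
def Step_S4 : Prop :=
  ∀ ν : ℝ, 0 < ν → ∀ (u₀ : E3 → E3) (u : ℝ → E3 → E3) (p : ℝ → E3 → ℝ),
    IsDatum u₀ → IsGlobalSolution ν u₀ u p → HasBoundedEnergy u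

/-! ### Kernel relations -/

/-- Step 4's statement holds (energy inequality in the BKM class, as in the C13 skeleton's `clay_of_claimed`).
[cite: TongTon2026, Step 4 p. 21] -/
theorem step_S4_holds : Step_S4 := by
  intro ν hν u₀ u p hdat hsol
  have key : ∀ S : ℝ, 0 < S → ∀ τ ∈ Icc (0:ℝ) S,
      ∫⁻ x, ‖u τ x‖ₑ ^ 2 = ENNReal.ofReal (∫ x, ‖u τ x‖ ^ 2) := by
    intro S hS τ hτ
    have hcl : IsClassicalNSSolutionOn (Icc 0 S) ν 0 u p :=
      hsol.isClassical.mono Icc_subset_Ici_self (uniqueDiffOn_Icc hS)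
    obtain ⟨C, hC⟩ := hsol.sobolev S 0
    have hfin0 : ∫⁻ x, ‖iteratedFDeriv ℝ 0 (u τ) x‖ₑ ^ 2 < ⊤ := (hC τ hτ).trans_lt ENNReal.coe_lt_top
    have heq : (fun x => ‖iteratedFDeriv ℝ 0 (u τ) x‖ₑ ^ 2) = fun x => ‖u τ x‖ₑ ^ 2 := by
      funext x
      rw [← ofReal_norm, norm_iteratedFDeriv_zero, ofReal_norm]
    have hfin : ∫⁻ x, ‖u τ x‖ₑ ^ 2 < ⊤ := by rwa [heq] at hfin0
    have hint : Integrable (fun x => ‖u τ x‖ ^ 2) :=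
      integrable_sq_norm_of_lintegral_lt_top (hcl.contDiff_velocity hτ).continuous hfin
    rw [ofReal_integral_eq_lintegral_ofReal hint (Eventually.of_forall fun x => sq_nonneg _)]
    refine lintegral_congr fun x => ?_
    rw [← ofReal_norm, ENNReal.ofReal_pow (norm_nonneg _)]
  refine ⟨∫⁻ x, ‖u₀ x‖ₑ ^ 2, ?_, fun t ht => ?_⟩
  · have h0 := hdat.2.2 0
    have heq : (fun x => ‖iteratedFDeriv ℝ 0 u₀ x‖ₑ ^ 2) = fun x => ‖u₀ x‖ₑ ^ 2 := by
      funext x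
      rw [← ofReal_norm, norm_iteratedFDeriv_zero, ofReal_norm]
    rwa [heq] at h0
  · have hT : (0:ℝ) < t + 1 := by linarith
    have hcl : IsClassicalNSSolutionOn (Icc 0 (t + 1)) ν 0 u p :=
      hsol.isClassical.mono Icc_subset_Ici_self (uniqueDiffOn_Icc hT)
    have hE : ∫ x, ‖u t x‖ ^ 2 ≤ ∫ x, ‖u 0 x‖ ^ 2 :=
      hcl.bkm_energy_le hν.le hT (hsol.sobolev (t + 1)) ⟨ht, by linarith⟩
    rw [key (t + 1) hT t ⟨ht, by linarith⟩, ← hsol.initial, key (t + 1) hT 0 ⟨le_rfl, hT.le⟩]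
    exact ENNReal.ofReal_le_ofReal hE

/-- **KERNEL COMPOSITION** — Theorem 1 (sufficiency, rendered) from Lemma 4 (rendered) and Step 4.
[cite: TongTon2026, Theorem 1 p. 17; Sufficiency Steps 1–4 pp. 17–21] -/
theorem claim_of_steps (h4 : Lemma4) (hS4 : Step_S4) : ClaimedTheorem := by
  intro ν hν u₀ hdat
  obtain ⟨u, p, hsol⟩ := h4 ν hν u₀ hdat
  exact ⟨u, p, hsol, hS4 ν hν u₀ u p hdat hsol⟩

/-- With Step 4 discharged, the claim reduces to Lemma 4 (rendered) alone.
[cite: TongTon2026, Theorem 1 p. 17] -/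
theorem claim_of_lemma4 (h4 : Lemma4) : ClaimedTheorem :=
  claim_of_steps h4 step_S4_holds

/-- The necessity half holds in the rendered class (smoothness of the slice at `t = 0` and divergence
freeness are part of a classical solution). [cite: TongTon2026, Necessity pp. 21–22] -/
theorem claimedNecessity_holds : ClaimedNecessity := by
  intro ν hν u₀ u p hsol
  have h0 : (0:ℝ) ∈ Ici (0:ℝ) := Set.mem_Ici.2 le_rfl
  refine ⟨?_, ?_⟩
  · rw [← hsol.initial]; exact hsol.isClassical.contDiff_velocity h0
  · rw [← hsol.initial]; exact hsol.isClassical.divFree 0 h0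

/-- **Clay link (TYPING-HYGIENE 10(a))**: the claimed theorem implies Clay (A). PROVED (restriction to
Schwartz data; the bounded-energy clause is part of the claim). [cite: TongTon2026, Theorem 1 p. 17] -/
theorem clay_of_claimed (hC : ClaimedTheorem) : ClayVariants.clayR3.Regularity := by
  intro ν hν u₀ hu₀ hdiv hdecay
  have hdat : IsDatum u₀ :=
    ⟨hu₀, fun x => hdiv x, fun n => hdecay.lintegral_enorm_iteratedFDeriv_sq_lt_top n⟩
  obtain ⟨u, p, hsol, hE⟩ := hC ν hν u₀ hdat
  obtain ⟨hns, hsu, hsp⟩ :=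
    (isNavierStokesSolution_and_smooth_iff (ν := ν) (f := 0) (u₀ := u₀) (u := u) (p := p)).2
      ⟨hsol.isClassical, hsol.initial⟩
  exact ⟨u, p, hsu, hsp, hns, hE⟩

end Literature.Claims.NS.TongTon2020

end
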